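import Literature.NumberTheory.EllipticCurves.TateCurve.NumberFieldUniformization
import Literature.NumberTheory.EllipticCurves.MinimalModelVariableChangeIntegralProofs
import Literature.NumberTheory.EllipticCurves.IwasawaSelmerSupersingularLocalProofs
import HarnessLib

/-!
# Tate's `v`-adic uniformisation and the kernel of reduction: `Φ(1 + 𝔪) ⊆ E₁(K̄_v)`
# (Silverman, *ATAEC* §V.4 «Reduction of the Tate curve», with Thm. V.5.3 / V.3.1; theorems only)

Topic `Literature/NumberTheory/EllipticCurves/TateCurve`, namespace
`Literature.NumberTheory.EllipticCurves.TateCurve` (LEAD `bsd-wall-utd-p1`, crux r205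
stmt-BirchSwinnertonDyer-24737 `TwinAlgMuZeroAtThree`, line `beta-road`, K2 stub readout/LINK at `v ∣ 3`:
the Tate-REDUCTION adapter between the tree's two Greenberg data at a multiplicative place — the Tate
datum `Φ(μ)` of `X2.GreenbergVatsalTateDatum` and the kernel-of-reduction datum
`WeierstrassCurve.kernelOfReductionLocalDatum` / `localKernelOfReduction` used by x9's Howard readout).

For an elliptic curve `E = W` over a number field `K` (`K : Type`) with SPLIT multiplicative
reduction at a finite place `v`, the tree's PROVED Tate uniformisation
(`Silverman1994_thmV53_tateUniformisation_holds`, abc-iut cell: `q ∈ K_v`, `0 < |q|_v < 1`, a change of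
variables `C` over `K_v` with `C • (W ⊗ K_v) = E_q`, and Tate's map `u ↦ (X(u,q), Y(u,q))` summed in
`K̄_v`) is re-assembled here with ONE MORE CLAUSE, the first line of Silverman's §V.4: a unit
`u ∈ K̄_vˣ` with `|u − 1|_v < 1` (a principal unit) is sent into the KERNEL OF REDUCTION
`E₁(K̄_v) = W.localKernelOfReduction v` (the points whose `x`-coordinate on a minimal model at `v`
has `|x|_v > 1`). Proof: `|X(1 + t, q)| = |t|⁻² > 1` (tree `norm_tateX_one_add`, computed in the
complete field `K_v(t)` and read in `K̄_v` through `map_tateX_of_mem`); the Tate equation `E_q` is a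
MINIMAL model at `v` (`tateCurve_isMinimal`), so it differs from the tree's chosen minimal model by a
change of variables `[u; r, s, t]` with `|u| = 1`, `|r| ≤ 1` (Silverman *AEC* VII.1.3(b), tree
`VariableChange.v_u_eq_one_and_v_r_le_one_of_isMinimal`), under which the criterion `|x| > 1` is
unchanged (`VariableChange.one_lt_v_toX_iff`).

* `norm_tateX_one_add_of_isAlgebraic` — `‖X(1 + t, q)‖ = ‖t‖⁻²` for `0 < ‖t‖ < 1` in an ALGEBRAIC
  normed extension `F` of the complete field `K` (e.g. `F = K̄`), not only in a complete one;
* **`exists_tateUniformisation_localKernelOfReduction`** — Thm. V.5.3 (split case) WITH the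
  reduction clause `|u − 1|_v < 1 → Φ u ∈ E₁(K̄_v)`.

Consumers: the all-`σ` Kummer compatibility of the kernel-of-reduction datum at a split
multiplicative `v ∣ p` (a `p`-power torsion point `σP − P` is `Φ(ζ)` with `ζ ∈ μ_{p^∞} ⊂ 1 + 𝔪`),
hence Greenberg's `Im κ ⊆ Im λ` (LNM 1716 §2 p. 76) for `C_v = E[p^∞] ∩ E₁(K̄_v)` and the local
inclusion KS(v) `localKerOver ≤ strictKer` consumed by
`ZpExtensionEisensteinReadoutOrdinaryLocalKummerStrictMultiplicativeThreeProofs`.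
BSD is not proved by any of this.

## References
* [SilvermanATAEC1994] J. H. Silverman, *Advanced Topics in the Arithmetic of Elliptic Curves*,
  GTM 151, Springer 1994, Thm. V.3.1 (c),(d) (PDF pp. 395–399), §V.4 (PDF pp. 399–405),
  Thm. V.5.3 (PDF pp. 407–409).
* [SilvermanAEC2009] J. H. Silverman, *The Arithmetic of Elliptic Curves*, 2nd ed., Prop. VII.1.3(b),
  Props. VII.2.1–2.2.
* [GreenbergLNM1716] R. Greenberg, *Iwasawa theory for elliptic curves*, LNM 1716 (1999), §2 pp. 73, 76.
-/

noncomputable section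

open scoped Classical NNReal
open NumberField IsDedekindDomain WeierstrassCurve Field

namespace Literature.NumberTheory.EllipticCurves.TateCurve

open SteinWuthrich2013 Literature.NumberTheory.EllipticCurves
  Literature.NumberTheory.GaloisRepresentations IsDedekindDomain.HeightOneSpectrum

/-! ## §1 `‖X(1 + t, q)‖ = ‖t‖⁻²` in an algebraic normed extension -/

section Algebraic

universe u

variable {K : Type u} [NontriviallyNormedField K] [CompleteSpace K]
  {F : Type u} [NormedField F] [NormedAlgebra K F] [IsUltrametricDist F] [Algebra.IsAlgebraic K F]

/-- **`‖X(1 + t, q)‖ = ‖t‖⁻²`** for `0 < ‖t‖ < 1` and `q ∈ K`, `‖q‖ < 1`, in an algebraic ultrametric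
normed extension `F` of the complete field `K` («we are really working in the complete field
`K(t)`»: the tree's `norm_tateX_one_add` in `K(t)`, read in `F` through `map_tateX_of_mem`).
[cite: SilvermanATAEC1994, Thm. V.3.1 (c) (PDF pp. 396, 398)] -/
theorem norm_tateX_one_add_of_isAlgebraic {q : K} (hq : ‖q‖ < 1) {t : F} (ht0 : t ≠ 0)
    (ht : ‖t‖ < 1) : ‖tateX (algebraMap K F q) (1 + t)‖ = ‖t‖⁻¹ ^ 2 := by
  obtain ⟨E, hE, htE⟩ :=
    exists_mem_intermediateField_finiteDimensional K (Algebra.IsAlgebraic.isAlgebraic (R := K) t)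
  haveI := hE
  letI : NontriviallyNormedField E := IntermediateField.nontriviallyNormedField E
  haveI : CompleteSpace E := completeSpace_intermediateField K E
  haveI : IsUltrametricDist E := IntermediateField.isUltrametricDist E
  have hqE : algebraMap K F q ∈ E := E.algebraMap_mem q
  have h1t : (1 : F) + t ∈ E := add_mem (one_mem E) htE
  rw [map_tateX_of_mem K E hqE h1t (norm_algebraMap_lt_one (F := F) hq)]
  have hqE' : ‖(⟨algebraMap K F q, hqE⟩ : E)‖ < 1 := norm_algebraMap_lt_one (F := F) hq
  have ht0' : (⟨t, htE⟩ : E) ≠ 0 := fun h => ht0 (congrArg Subtype.val h)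
  have ht' : ‖(⟨t, htE⟩ : E)‖ < 1 := ht
  have e1 : (⟨(1 : F) + t, h1t⟩ : E) = 1 + ⟨t, htE⟩ := Subtype.ext rfl
  rw [e1]
  exact norm_tateX_one_add hqE' ht0' ht'

end Algebraic

/-! ## §2 Thm. V.5.3 (split case) with the reduction clause `Φ(1 + 𝔪) ⊆ E₁(K̄_v)` -/

section NumberField

variable {K : Type} [Field K] [NumberField K] (W : WeierstrassCurve K) [W.IsElliptic]
  (v : HeightOneSpectrum (𝓞 K))

namespace VariableChangeAux

/-- Composition of substitutions on the `x`-coordinate (a `private`-style local copy of the tree's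
`VariableChange.toX_mul`). [cite: SilvermanAEC2009, III.1 Table 3.1] -/
theorem toX_mul {L : Type*} [Field L] (C C' : VariableChange L) (x : L) :
    (C * C').toX x = C.toX (C'.toX x) := by
  simp only [VariableChange.toX_def, VariableChange.mul_def, Units.val_mul, Units.val_inv_eq_inv_val]
  have hC' : (C'.u : L) ≠ 0 := C'.u.ne_zero
  field_simp
  ring

end VariableChangeAux

/-- **Silverman ATAEC Thm. V.5.3 (with V.3.1 (c)(d)) AND the first line of §V.4, PROVED**: for an
elliptic curve `W` over a number field `K` with split multiplicative reduction at `v`, there are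
`q ∈ K_v`, `q ≠ 0`, `|q|_v < 1`, and a surjective homomorphism `Φ : K̄_vˣ → E(K̄_v)` with kernel `q^ℤ`,
`Γ_{K_v}`-equivariant — the four clauses of the tree's named fact
`Silverman1994_thmV53_tateUniformisation` — such that moreover **every principal unit
`u` (`|u − 1|_v < 1`) is sent into the kernel of reduction `E₁(K̄_v)`** («`φ(1 + 𝔪) = E_{q,1}`»,
ATAEC §V.4): `|X(u, q)|_v = |u − 1|_v⁻² > 1` on the Tate model, which is a minimal model at `v`, and
the criterion `|x|_v > 1` does not depend on the minimal model (AEC VII.1.3(b)).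
[cite: SilvermanATAEC1994, Thm. V.5.3 (PDF pp. 407–409), Thm. V.3.1 (c)(d) (PDF pp. 395–399), §V.4 (PDF p. 399)]
[cite: SilvermanAEC2009, Prop. VII.1.3(b) and Props. VII.2.1–2.2] -/
theorem exists_tateUniformisation_localKernelOfReduction (hsplit : W.HasSplitMultiplicativeReductionAt v) :
    ∃ (q : v.adicCompletion K)
      (Φ : Additive (AlgebraicClosure (v.adicCompletion K))ˣ →+ localPoints W (v.adicCompletion K)),
      q ≠ 0 ∧ Valued.v q < 1 ∧
      Function.Surjective Φ ∧
      (∀ u : (AlgebraicClosure (v.adicCompletion K))ˣ, Φ (Additive.ofMul u) = 0 ↔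
        ∃ n : ℤ, (u : AlgebraicClosure (v.adicCompletion K)) =
          algebraMap (v.adicCompletion K) (AlgebraicClosure (v.adicCompletion K)) q ^ n) ∧
      (∀ (σ : absoluteGaloisGroup (v.adicCompletion K))
          (u : (AlgebraicClosure (v.adicCompletion K))ˣ),
        σ • Φ (Additive.ofMul u) =
          Φ (Additive.ofMul (Units.map
            (Field.absoluteGaloisGroup.toAlgEquiv (v.adicCompletion K) σ :
              AlgebraicClosure (v.adicCompletion K) →* AlgebraicClosure (v.adicCompletion K))
            u))) ∧
      (∀ u : (AlgebraicClosure (v.adicCompletion K))ˣ,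
        v.spectralValuation ((u : AlgebraicClosure (v.adicCompletion K)) - 1) < 1 →
        Φ (Additive.ofMul u) ∈ W.localKernelOfReduction v) := by
  letI := Literature.NumberTheory.GaloisRepresentations.Ultrametric.AdicCompletion.nontriviallyNormedField K v
  haveI := charZero_adicCompletion' K v
  -- V.5.3: the Tate parameter and the `K_v`-isomorphism `C • (W ⊗ K_v) = E_q`
  obtain ⟨q, hq0, hq, -, -, C, hC⟩ :=
    exists_tateParameter_of_hasSplitMultiplicativeReductionAt K v W hsplit
  -- `K̄_v` with the spectral norm
  set L := AlgebraicClosure (v.adicCompletion K) with hL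
  letI : NontriviallyNormedField L :=
    spectralNorm.nontriviallyNormedField (v.adicCompletion K) L
  letI : NormedAlgebra (v.adicCompletion K) L := spectralNorm.normedAlgebra (v.adicCompletion K) L
  haveI : IsUltrametricDist L :=
    IsUltrametricDist.isUltrametricDist_of_isNonarchimedean_norm
      (isNonarchimedean_spectralNorm (K := v.adicCompletion K) (L := L))
  -- V.3.1 (c)(d): Tate's map `u ↦ (X(u,q), Y(u,q))`, summed in `K̄_v`
  let φ : Additive Lˣ →+ geomPoints (tateCurve q) :=
    { toFun := fun a => tatePointAlg q (Additive.toMul a)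
      map_zero' := tatePointAlg_of_eq_zpow (F := L) (q := q) 1 (n := 0) (by simp)
      map_add' := fun a b => by
        simp only [toMul_add]
        exact tatePointAlg_mul addRelX_eq_zero addRelY_eq_zero hq0 hq _ _ }
  have hφ : ∀ u : Lˣ, φ (Additive.ofMul u) = tatePointAlg q u := fun _ => rfl
  have hsurj : Function.Surjective φ := by
    intro P
    obtain ⟨u, hu⟩ := tatePointAlg_surjective (F := L) addRelX_eq_zero addRelY_eq_zero hq0 hq P
    exact ⟨Additive.ofMul u, hu⟩
  have hker : ∀ u : Lˣ, φ (Additive.ofMul u) = 0 ↔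
      ∃ n : ℤ, (u : L) = algebraMap (v.adicCompletion K) L q ^ n :=
    fun u => tatePointAlg_eq_zero_iff hq0 hq u
  have hequiv : ∀ (σ : absoluteGaloisGroup (v.adicCompletion K)) (u : Lˣ),
      σ • φ (Additive.ofMul u) =
        φ (Additive.ofMul (Units.map
          (absoluteGaloisGroup.toAlgEquiv (v.adicCompletion K) σ : L →* L) u)) := by
    intro σ u
    rw [hφ, hφ]
    exact map_algEquiv_tatePointAlg hq0 hq (absoluteGaloisGroup.toAlgEquiv (v.adicCompletion K) σ) u
  let e := localPointsEquivTate W v C hC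
  refine ⟨q, e.symm.toAddMonoidHom.comp φ, hq0, ?_, ?_, ?_, ?_, ?_⟩
  · exact (Valued.toNormedField.norm_lt_one_iff).mp hq
  · exact e.symm.surjective.comp hsurj
  · intro u
    rw [← hker u]
    change e.symm (φ (Additive.ofMul u)) = 0 ↔ _
    rw [AddEquiv.map_eq_zero_iff]
  · intro σ u
    change σ • e.symm (φ (Additive.ofMul u)) = e.symm (φ _)
    rw [← hequiv σ u]
    apply e.injective
    rw [AddEquiv.apply_symm_apply, localPointsEquivTate_smul, AddEquiv.apply_symm_apply]
  · -- the reduction clause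
    intro u hu1
    have hw := coe_spectralValuation v
    change e.symm (φ (Additive.ofMul u)) ∈ W.localKernelOfReduction v
    rw [hφ]
    by_cases h1 : (u : L) = 1
    · -- `u = 1 = q⁰ ↦ O ∈ E₁`
      have h0 : tatePointAlg q u = 0 :=
        tatePointAlg_of_eq_zpow u (n := 0) (by rw [h1, zpow_zero])
      rw [h0]
      change e.symm (0 : geomPoints (tateCurve q)) ∈ W.localKernelOfReduction v
      rw [map_zero]
      exact AddSubgroup.zero_mem _
    · -- `u = 1 + t`, `0 < |t| < 1`
      set t : L := (u : L) - 1 with ht_def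
      have ht0 : t ≠ 0 := fun h => h1 (sub_eq_zero.mp h)
      have hnorm : ∀ x : L, ‖x‖ = (v.spectralValuation x : ℝ) := fun x => by rw [hw]; rfl
      have ht : ‖t‖ < 1 := by
        rw [hnorm, ← NNReal.coe_one, NNReal.coe_lt_coe]; exact hu1
      have hut : (u : L) = 1 + t := by rw [ht_def]; ring
      have hunorm : ‖(u : L)‖ = 1 := by
        rw [hut]; exact norm_one_add_eq_one ht
      -- `u ∉ q^ℤ`
      have hqL : ‖algebraMap (v.adicCompletion K) L q‖ < 1 := norm_algebraMap_lt_one hq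
      have hqL0 : algebraMap (v.adicCompletion K) L q ≠ 0 := (map_ne_zero _).mpr hq0
      have hu' : ∀ n : ℤ, (u : L) ≠ algebraMap (v.adicCompletion K) L q ^ n := by
        intro n hn
        have hn1 : ‖algebraMap (v.adicCompletion K) L q‖ ^ n = 1 := by
          rw [← norm_zpow, ← hn, hunorm]
        rcases lt_trichotomy n 0 with hneg | rfl | hpos
        · have : 1 < ‖algebraMap (v.adicCompletion K) L q‖ ^ n :=
            one_lt_zpow_of_neg₀ (norm_pos_iff.mpr hqL0) hqL hneg
          exact absurd hn1 (ne_of_gt this)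
        · exact h1 (by rw [hn, zpow_zero])
        · have : ‖algebraMap (v.adicCompletion K) L q‖ ^ n < 1 :=
            zpow_lt_one₀ (norm_pos_iff.mpr hqL0) hqL hpos
          exact absurd hn1 (ne_of_lt this)
      have hP : tatePointAlg q u = .some _ _ (nonsingular_tate_alg hq0 hq u hu') :=
        tatePointAlg_of_ne_zpow hq0 hq u hu'
      -- `|X(u, q)| = |t|⁻² > 1`
      have hX : 1 < ‖tateX (algebraMap (v.adicCompletion K) L q) (u : L)‖ := by
        rw [hut, norm_tateX_one_add_of_isAlgebraic hq ht0 ht]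
        have : 1 < ‖t‖⁻¹ := one_lt_inv_iff₀.mpr ⟨norm_pos_iff.mpr ht0, ht⟩
        nlinarith
      have hXw : 1 < v.spectralValuation (tateX (algebraMap (v.adicCompletion K) L q) (u : L)) := by
        rw [← NNReal.coe_lt_coe, NNReal.coe_one, ← hnorm]; exact hX
      -- the point `P = Φ u` of `W ⊗ K̄_v` and its coordinates
      set P : localPoints W (v.adicCompletion K) := e.symm (tatePointAlg q u) with hP_def
      have heP : e P = tatePointAlg q u := by rw [hP_def, AddEquiv.apply_symm_apply]
      change (W.baseChange L).toAffine.Point at P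
      rcases hPc : P with _ | ⟨x, y, hxy⟩
      · exact AddSubgroup.zero_mem _
      · -- `X(u,q) = (C ⊗ K̄_v).toX x`
        have hXeq : (C.map (algebraMap (v.adicCompletion K) L)).toX x =
            tateX (algebraMap (v.adicCompletion K) L q) (u : L) := by
          have h2 : e (show localPoints W (v.adicCompletion K) from .some x y hxy) = tatePointAlg q u := by
            rw [← hPc]; exact heP
          have step : e (show localPoints W (v.adicCompletion K) from .some x y hxy) =
              Affine.Point.congrEquiv (congrArg (fun X : WeierstrassCurve (v.adicCompletion K) ↦
                X.baseChange L) hC)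
                (VariableChange.pointEquivBaseChange (W.baseChange (v.adicCompletion K)) C L
                  (Affine.Point.congrEquiv (W.baseChange_baseChange_adicCompletion v).symm
                    (.some x y hxy))) := rfl
          rw [Affine.Point.congrEquiv_some, VariableChange.pointEquivBaseChange_some,
            Affine.Point.congrEquiv_some] at step
          rw [step, hP] at h2
          exact ((Affine.Point.some.injEq _ _ _ _ _ _).mp h2).1
        -- two minimal models at `v`: the Tate model `C • W_v` and the chosen one `Cv • W_v`
        set Cv : VariableChange (v.adicCompletion K) :=
          ((W.baseChange (v.adicCompletion K)).exists_isMinimal (v.adicCompletionIntegers K)).choose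
          with hCv
        haveI hminv : (Cv • W.baseChange (v.adicCompletion K)).IsMinimal (v.adicCompletionIntegers K) :=
          ((W.baseChange (v.adicCompletion K)).exists_isMinimal (v.adicCompletionIntegers K)).choose_spec
        haveI hminT : (C • W.baseChange (v.adicCompletion K)).IsMinimal (v.adicCompletionIntegers K) := by
          rw [hC]
          exact tateCurve_isMinimal (v.adicCompletionIntegers K)
            (norm_le_one_iff_mem_range_adicCompletionIntegers K v) hq
        have hΔ : (W.baseChange (v.adicCompletion K)).Δ ≠ 0 :=
          (W.baseChange (v.adicCompletion K)).isUnit_Δ.ne_zero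
        have hVv := valued_le_one_iff_mem_range_adicCompletionIntegers (K := K) v
        obtain ⟨hu, hr⟩ := VariableChange.v_u_eq_one_and_v_r_le_one_of_isMinimal hVv
          (W.baseChange (v.adicCompletion K)) C Cv hΔ
        set D := Cv * C⁻¹ with hD
        have huL : v.spectralValuation
            (((D.map (algebraMap (v.adicCompletion K) L)).u : L)) = 1 := by
          rw [VariableChange.map_u, Units.coe_map, MonoidHom.coe_coe]
          apply NNReal.coe_injective
          rw [coe_spectralValuation_algebraMap hw, NumberField.FinitePlace.norm_def, hu, map_one]
        have hrL : v.spectralValuation ((D.map (algebraMap (v.adicCompletion K) L)).r) ≤ 1 := by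
          rw [VariableChange.map_r, spectralValuation_algebraMap_le_one_iff hw, mem_adicCompletionIntegers]
          exact hr
        have hfac : Cv.map (algebraMap (v.adicCompletion K) L) =
            D.map (algebraMap (v.adicCompletion K) L) * C.map (algebraMap (v.adicCompletion K) L) := by
          have hCvD : Cv = D * C := by rw [hD, inv_mul_cancel_right]
          conv_lhs => rw [hCvD]
          exact (VariableChange.mapHom (algebraMap (v.adicCompletion K) L)).map_mul D C
        -- the criterion `|x| > 1` on the chosen minimal model
        have hQ : W.localPointsEquivModel v (show localPoints W (v.adicCompletion K) from .some x y hxy) =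
            .some ((Cv.map (algebraMap (v.adicCompletion K) L)).toX x)
              ((Cv.map (algebraMap (v.adicCompletion K) L)).toY x y) ?_ := by
          rw [localPointsEquivModel_apply, localPointsEquivPoint_apply]
          change Affine.Point.congrEquiv _ (VariableChange.pointEquivBaseChange _ _ _
            (Affine.Point.congrEquiv _ (.some x y hxy))) = _
          rw [Affine.Point.congrEquiv_some, VariableChange.pointEquivBaseChange_some,
            Affine.Point.congrEquiv_some]
        refine (W.mem_localKernelOfReduction_iff_of_eq_some v hQ).mpr ?_
        rw [hfac, VariableChangeAux.toX_mul, VariableChange.one_lt_v_toX_iff _ huL hrL, hXeq]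
        exact hXw

end NumberField

end Literature.NumberTheory.EllipticCurves.TateCurve

end
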